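import Summits.Ventures.QEC.CircuitDistance.PortK2DataBB144X
import Summits.Ventures.QEC.CircuitDistance.K2Chunks
import HarnessLib

/-!
# K2(`[[144,12,12]]`) chunk module — COMPUTATIONAL (native_decide; `Lean.ofReduceBool`)

Cell `qec`, CDX, R146/R152 STEP 1 («computational» header; `ofReduceBool` confined to these chunk modules). Checker of record
`K2.K2Data` (qec-cdx-type-1, PortK2Check); data module of record `PortK2DataBB144X/Z` (p669158/9, crit-1 data audit PASS
2026-08-28T21:20Z); chunk glue `K2Chunks` (idea-1 g2). Cube 1, child 6: leaf group 1 of 3.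
Leaf theorems: the K2 DFS accepts below one descendant state of pivot cube 1 (sector X); sizes are exact DFS visit counts
(eng-1 g2 `k2count.c`), capped so that the gate's native-axiom audit re-verifies every leaf in place. Assemblies re-derive the
child lists in the kernel (`decide`) and end in the literal cube fact `d144X.cube (Ts144X.getD 1 []) (72) (lives144X.getD 1 0) = true`
(the `hcubes` hypothesis of `K2Inst.k2_complete`). Emitted by qec-cdx-eng-1 g2 (`gen2.py`, idea-1's `gen_k2chunks_from_lean.py` lineage).
-/

namespace Summit.Ventures.QEC.CircuitDistance.K2

set_option maxRecDepth 100000 in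
set_option maxHeartbeats 0 in
set_option exponentiation.threshold 1024 in
/-- K2(144) chunk fact `cube144X1_ch6_0` (445934 DFS visits; see the module docstring). -/
theorem cube144X1_ch6_0 : app5 (d144X.dfs (Ts144X.getD 1 []) 6) (166020696663395270920, 912, 822752278660603021077484591278675252491382099916238540609945600, 3, 2348542582773833227889480596789337027375682548079127089506751985068051893083996696954289935712070563310600192) = true := by native_decide

set_option maxRecDepth 100000 in
set_option maxHeartbeats 0 in
set_option exponentiation.threshold 1024 in
/-- K2(144) chunk fact `cube144X1_ch6_1` (344073 DFS visits; see the module docstring). -/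
theorem cube144X1_ch6_1 : app5 (d144X.dfs (Ts144X.getD 1 []) 6) (166453042227622314240, 2000, 822752278660603021077484931561042173429836118557880233087729664, 3, 2348542582773833227889480596789337027375682548079127089506751985068051552801629776015826472337463131542388736) = true := by native_decide

set_option maxRecDepth 100000 in
set_option maxHeartbeats 0 in
set_option exponentiation.threshold 1024 in
/-- K2(144) chunk fact `cube144X1_ch6_2` (438643 DFS visits; see the module docstring). -/
theorem cube144X1_ch6_2 : app5 (d144X.dfs (Ts144X.getD 1 []) 6) (166020696672118507776, 2205, 822752278660603021255890552866920237623658401364459693367361536, 3, 2348542582773833227889480596789337027375682548079127089506751984889645591213384790883540726156276239494545408) = true := by native_decide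

set_option maxRecDepth 100000 in
set_option maxHeartbeats 0 in
set_option exponentiation.threshold 1024 in
/-- K2(144) chunk fact `cube144X1_ch6_3` (149435 DFS visits; see the module docstring). -/
theorem cube144X1_ch6_3 : app5 (d144X.dfs (Ts144X.getD 1 []) 6) (498354832762038780160, 3728, 822752670979461482745032331015514202970523661580488080321675264, 3, 2348542582773833227889480596789337027375682548079126697187893523222097851476545840404389719759060960492388352) = true := by native_decide

set_option maxRecDepth 100000 in
set_option maxHeartbeats 0 in
set_option exponentiation.threshold 1024 in
/-- K2(144) chunk fact `cube144X1_ch6_4` (333483 DFS visits; see the module docstring). -/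
theorem cube144X1_ch6_4 : app5 (d144X.dfs (Ts144X.getD 1 []) 6) (2509045987350612934656, 2256, 822777387067544567800539934436368083157037064605050657457569792, 3, 2348542582773833227889480596789337027375682548079101588780951976499042508318853009738725310337283104354336768) = true := by native_decide

set_option maxRecDepth 100000 in
set_option maxHeartbeats 0 in
set_option exponentiation.threshold 1024 in
/-- K2(144) chunk fact `cube144X1_ch6_5` (376267 DFS visits; see the module docstring). -/
theorem cube144X1_ch6_5 : app5 (d144X.dfs (Ts144X.getD 1 []) 6) (21040817459083610368, 2005, 835607783014674943281820288017404553311550279133535144001929216, 3, 2348542582773833227889480596789337027375682548066246084426880054294706811580123708918547686387020761671925760) = true := by native_decide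
end Summit.Ventures.QEC.CircuitDistance.K2
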